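import Summits.CriticalPhenomena.PercolationContinuityZ3.Theorems.Transplant.FKConnectivityAllQPRStock
import HarnessLib

/-!
# Connectivity correlation inequalities for `φ_{w,q}`, every `q > 0` — the Potts–Rayleigh stock: SUBDIVISIONS, PARALLEL PATHS and
# PENDANT EDGES (the elementary steps of the Dirac–Lovász reduction)

Support file (`--supports stmt-CriticalPhenomena-4575`), FK sub-lane `prim-bschramm-fk-3` (gen 19) of the post-continuity programme;
builds on p205010 (kernel theorem, internal audit signed; external expert review pending).  No definitions, no named facts, no sorries.

The informal corollary recorded with `FK.IsPRStock` (every finite graph with no two vertex-disjoint cycles is Potts–Rayleigh on `(0,1]`,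
via Dirac's and Lovász's structure theorems, Bollobás 1978 Ch. III Thms. 2.1–2.2) reduces an arbitrary such graph to the listed
3-connected / `δ ≥ 3` cores by three elementary operations.  This file makes those operations tree lemmas, so that only the
classification itself remains informal:
* **`FK.IsPRStock.glueTriangle`** — if `E` is in the stock, `xy ∈ E` and `v` is a fresh vertex, then `E ∪ {xv, vy}` is in the stock
  (parallel connection with the 2-tree `{xy, xv, vy}` along `xy`).  Iterating gives internally disjoint `x–y` paths of any length
  next to `xy` ("fat edges").
* **`FK.edgeNegCorrSupp_subdivide`** — subdividing a pair of a member (`(E ∖ {xy}) ∪ {xv, vy}`) gives a Potts–Rayleigh support (a subset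
  of the glued member).
* **`FK.edgeNegCorrSupp_pendant`** — attaching a pendant pair `xv` (`v` fresh) at a covered vertex `x` of a member gives a Potts–Rayleigh
  support; iterating attaches pendant trees.
[cite: Bollobas1978, Ch. III §2 Thms. 2.1–2.2] [cite: Wagner2006, Thm. 5.8, §5.3 (pp. 14–15)] [cite: Grimmett2006, §3.9 eq. (3.94) (pp. 63–64)]
-/

noncomputable section

namespace Summit.CriticalPhenomena.PercolationContinuityZ3.Theorems

namespace FK

open MeasureTheory Literature.Probability.LatticeModels Literature.Probability.Percolation
open scoped Classical

variable {V : Type*} [Fintype V]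

/-- **Gluing a triangle onto a pair of a member**: if `E ∈ IsPRStock`, `xy ∈ E` (`x ≠ y`) and no pair of `E` contains `v`, then
`E ∪ {xv, vy} ∈ IsPRStock` (parallel connection with the 2-tree `{xy, xv, vy}` along `xy`).  Iterated, this puts internally disjoint
`x–y` paths of every length next to `xy`. [cite: Wagner2006, Thm. 5.8, §5.3 (pp. 14–15)] [cite: Bollobas1978, Ch. III §2 Thms. 2.1–2.2] -/
theorem IsPRStock.glueTriangle {E : Set (Sym2 V)} (hE : IsPRStock E) {x y v : V} (hxy : x ≠ y) (hmem : s(x, y) ∈ E)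
    (hv : ∀ e ∈ E, v ∉ e) : IsPRStock (E ∪ {s(x, v), s(v, y)}) := by
  have hxv : x ≠ v := fun h => hv _ hmem (h ▸ Sym2.mem_mk_left x y)
  have hyv : y ≠ v := fun h => hv _ hmem (h ▸ Sym2.mem_mk_right x y)
  have hT : IsPRStock (({s(x, y)} : Set (Sym2 V)) ∪ {s(x, v), s(v, y)}) := IsPRStock.twoTree (isTwoTree_triangle hxy hxv hyv)
  have hglue := IsPRStock.glue hE hT hxy hmem (Set.mem_union_left _ (Set.mem_singleton _)) ?_ ?_
  · -- the union is `E ∪ {xv, vy}` since `xy ∈ E`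
    have hset : E ∪ (({s(x, y)} : Set (Sym2 V)) ∪ {s(x, v), s(v, y)}) = E ∪ {s(x, v), s(v, y)} := by
      rw [← Set.union_assoc, Set.union_eq_self_of_subset_right (Set.singleton_subset_iff.2 hmem)]
    rwa [hset] at hglue
  · -- disjointness: the other pairs of the triangle contain the fresh vertex `v`
    rw [Set.disjoint_left]
    rintro g ⟨hgE, hgxy⟩ hgT
    rcases hgT with hg | hg
    · exact hgxy hg
    · have hvg : v ∈ g := by
        rcases hg with rfl | rfl
        · exact Sym2.mem_mk_right x v
        · exact Sym2.mem_mk_left v y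
      exact hv g hgE hvg
  · -- the spans meet only in `{x, y}`
    rintro z ⟨g, hgE, hzg⟩ ⟨g', hg', hzg'⟩
    have hzv : z ≠ v := fun h => hv g hgE (h ▸ hzg)
    rcases hg' with hg' | hg' | hg'
    · rw [Set.mem_singleton_iff] at hg'; subst hg'
      exact (Sym2.mem_iff.1 hzg')
    · subst hg'
      rcases Sym2.mem_iff.1 hzg' with rfl | rfl
      · exact Or.inl rfl
      · exact (hzv rfl).elim
    · rw [Set.mem_singleton_iff] at hg'; subst hg'
      rcases Sym2.mem_iff.1 hzg' with rfl | rfl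
      · exact (hzv rfl).elim
      · exact Or.inr rfl

/-- **Subdividing a pair of a member gives a Potts–Rayleigh support** (`0 < q ≤ 1`): for `E ∈ IsPRStock`, `xy ∈ E`, `v` fresh, every weight
vector supported on `(E ∖ {xy}) ∪ {xv, vy}` gives an edge-negatively associated `φ_{w,q}`.
[cite: Bollobas1978, Ch. III §2 Thms. 2.1–2.2] [cite: Grimmett2006, §3.9 eq. (3.94) (pp. 63–64)] -/
theorem edgeNegCorrSupp_subdivide {q : ℝ} (hq0 : 0 < q) (hq1 : q ≤ 1) {E : Set (Sym2 V)} (hE : IsPRStock E) {x y v : V}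
    (hxy : x ≠ y) (hmem : s(x, y) ∈ E) (hv : ∀ e ∈ E, v ∉ e) :
    EdgeNegCorrSupp ((E \ {s(x, y)}) ∪ {s(x, v), s(v, y)}) q :=
  edgeNegCorrSupp_of_subset_prStock hq0 hq1 (hE.glueTriangle hxy hmem hv)
    (Set.union_subset_union_left _ fun _ h => h.1)

/-- **Attaching a pendant pair at a covered vertex gives a Potts–Rayleigh support** (`0 < q ≤ 1`): for `E ∈ IsPRStock`, a pair `xy ∈ E`
at `x` and a fresh vertex `v`, every weight vector supported on `E ∪ {xv}` gives an edge-negatively associated `φ_{w,q}`; iterate for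
pendant trees. [cite: Bollobas1978, Ch. III §2 Thms. 2.1–2.2] [cite: Grimmett2006, §3.9 eq. (3.94) (pp. 63–64)] -/
theorem edgeNegCorrSupp_pendant {q : ℝ} (hq0 : 0 < q) (hq1 : q ≤ 1) {E : Set (Sym2 V)} (hE : IsPRStock E) {x y v : V}
    (hxy : x ≠ y) (hmem : s(x, y) ∈ E) (hv : ∀ e ∈ E, v ∉ e) : EdgeNegCorrSupp (E ∪ {s(x, v)}) q :=
  edgeNegCorrSupp_of_subset_prStock hq0 hq1 (hE.glueTriangle hxy hmem hv)
    (Set.union_subset_union_right _ (Set.singleton_subset_iff.2 (Set.mem_insert _ _)))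

end FK

end Summit.CriticalPhenomena.PercolationContinuityZ3.Theorems

end
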